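import Summits.SmoothPoincare4.SmoothPoincare4.Theorems.DottedCircleRasmussenDcrGapHelperFriendsCarrierTkAux6

/-!
# Helper `helper_friendsCarrier_Tk_endFormulas` of stub `helper_friendsCarrier_Tk` — the end collar, part 1: formulas
(item stmt-SmoothPoincare4-16128, route route-SmoothPoincare4-DottedCircleRasmussen)

Start of the END COLLAR `c : Y × ℝ ≅ T ∖ C` of the relative open trace `T = TraceDatum.Trace`
(parts `…TkAux3–6`), porting the tree's `OpenTraceCollar.lean` (`k = 0`) through the dictionary
radial coordinate `t • a` ↦ collar clock `θ(s, a)`, `‖y‖⁻¹ ↦ E(G_k y - 1)`, `y/‖y‖ ↦ drop y`,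
`ν.toHomeo.symm ↦ ι₀`, `jA ↦ jM/ψ`; the flat regime (handle chart `ℝ² × ℝ²` and the surgery solid
torus) is the template's VERBATIM (`TubeNbhd.fF`, `kOf`, `ΨFlat`, `radF`, `jBt`).

* `FriendsTk.EndDatum k` — a trace datum whose tube is the fibre-shrunken `ν₀'` of a tube `ν₀`
  (`…TkAux7`), with `ν₀`'s own tube coordinates `ι₀` (all radii) and the knot `K₀ = ν₀(·, 0)`;
* `EndDatum.Presentation Y` — the data presenting `Y` as `M_k` surgered along `K₀` via `ν₀` (the
  hypothesis block of `helper_friendsCarrier_Tk`, bundled);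
* the three collar formulas `cRad`, `cTube`, `cFlat` and `collar`, the three inverse formulas `ΨRad`,
  `ΨTube`, `TubeNbhd.ΨFlat` and `collarInv`, and the branch evaluation of `collar`;
* `helper_friendsCarrier_Tk_endFormulas` — the registered summary (handle-chart form of collar points).

Everything is proved; the definitions are constructions, not named facts; no `sorry`.
References: Kirby (1989), Ch. I §5 [Kirby1989]; Gompf–Stipsicz (1999), §5.3; the tree's `OpenTraceCollar.lean`.
-/

-- the prescribed namespace `Summit.<P>.<Sub>.…` duplicates `SmoothPoincare4` (P = Sub)
set_option linter.dupNamespace false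
set_option linter.style.longLine false

noncomputable section

open scoped Manifold ContDiff Topology
open Function Set Metric
open Literature.Topology.FourManifolds Literature.Topology.FourManifolds.MMSW

namespace Summit.SmoothPoincare4.SmoothPoincare4.Theorems.DcrGap.MkFriends

namespace FriendsTk

/-- **End datum**: a trace datum (`…TkAux3`) whose tube `νK` is the fibre-shrunken
`ν₀'(u, w'') = ν₀(u, univBall 0 2 w'')` of a tube `ν₀ : 𝕊¹ × ℝ² → M_k` around the knot `K₀ = ν₀(·, 0)`
(`…TkAux7`), together with tube coordinates `ι₀` on the flowed-out tube of `ν₀` itself (piece (2)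
applied to `ν₀`: coordinates of ALL radii, across the frontier of the range of `ν₀'`). [folklore] -/
structure EndDatum (k : ℕ) extends TraceDatum k where
  /-- The (unshrunken) tube of the knot. -/
  ν₀ : (Metric.sphere (0 : EuclideanSpace ℝ (Fin 2)) 1) × EuclideanSpace ℝ (Fin 2) → EuclideanSpace ℝ (Fin 4)
  /-- The knot. -/
  K₀ : (Metric.sphere (0 : EuclideanSpace ℝ (Fin 2)) 1) → EuclideanSpace ℝ (Fin 4)
  /-- Tube coordinates on the flowed-out tube of `ν₀`. -/
  ι₀ : EuclideanSpace ℝ (Fin 4) → (Metric.sphere (0 : EuclideanSpace ℝ (Fin 2)) 1) × EuclideanSpace ℝ (Fin 2)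
  νK_eq : ∀ q, νK q = ν₀ (q.1, OpenPartialHomeomorph.univBall (0 : EuclideanSpace ℝ (Fin 2)) 2 q.2)
  contMDiff_ν₀ : ContMDiff ((𝓡 1).prod 𝓘(ℝ, EuclideanSpace ℝ (Fin 2))) 𝓘(ℝ, EuclideanSpace ℝ (Fin 4)) ∞ ν₀
  injective_ν₀ : Injective ν₀
  ν₀_mem : ∀ p, ν₀ p ∈ modelBoundary k
  ν₀_zero : ∀ u, ν₀ (u, 0) = K₀ u
  isOpen_flowTube₀ : IsOpen {y : EuclideanSpace ℝ (Fin 4) | (∀ j, (1 : ℝ) / 2 < holeTerm k j y) ∧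
    levelFun k y ∈ Ioo (1 - δ) (1 + δ) ∧ θ (1 - levelFun k y, y) ∈ range ν₀}
  contMDiffOn_ι₀ : ContMDiffOn 𝓘(ℝ, EuclideanSpace ℝ (Fin 4)) ((𝓡 1).prod 𝓘(ℝ, EuclideanSpace ℝ (Fin 2))) ∞ ι₀
    {y : EuclideanSpace ℝ (Fin 4) | (∀ j, (1 : ℝ) / 2 < holeTerm k j y) ∧
      levelFun k y ∈ Ioo (1 - δ) (1 + δ) ∧ θ (1 - levelFun k y, y) ∈ range ν₀}
  ι₀_θ : ∀ (q : (Metric.sphere (0 : EuclideanSpace ℝ (Fin 2)) 1) × EuclideanSpace ℝ (Fin 2)) (s : ℝ),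
    s ∈ Ioo (-δ) δ → ι₀ (θ (s, ν₀ q)) = q

namespace EndDatum

variable {k : ℕ} (E : EndDatum k)

/-! ### The tube `ν₀` in the band -/

/-- The clock along `θ(·, ν₀ q)`. [folklore] -/
theorem clock_ν₀ (q : (Metric.sphere (0 : EuclideanSpace ℝ (Fin 2)) 1) × EuclideanSpace ℝ (Fin 2)) {s : ℝ}
    (hs : s ∈ Ioo (-E.δ) E.δ) :
    (∀ j, (1 : ℝ) / 2 < holeTerm k j (E.θ (s, E.ν₀ q))) ∧ levelFun k (E.θ (s, E.ν₀ q)) = 1 + s := by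
  have hm := E.ν₀_mem q
  have hg : ∀ j, (1 : ℝ) / 2 < holeTerm k j (E.ν₀ q) := fun j => lt_of_lt_of_le (by norm_num) (hm.1 j)
  have hG : levelFun k (E.ν₀ q) ∈ Ioo (1 - E.δ) (1 + E.δ) := by
    rw [hm.2]; exact ⟨by linarith [E.δ_pos], by linarith [E.δ_pos]⟩
  have h := E.clock (E.ν₀ q) hg hG s (by rw [hm.2]; exact ⟨by linarith [hs.1], by linarith [hs.2]⟩)
  rw [hm.2] at h
  exact h

/-- `θ(s, ν₀ q) ∈ P` for `|s| < δ`. [folklore] -/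
theorem θ_ν₀_mem_hbNbhd (q : (Metric.sphere (0 : EuclideanSpace ℝ (Fin 2)) 1) × EuclideanSpace ℝ (Fin 2))
    {s : ℝ} (hs : s ∈ Ioo (-E.δ) E.δ) : E.θ (s, E.ν₀ q) ∈ E.hbNbhd := by
  obtain ⟨hg, hG⟩ := E.clock_ν₀ q hs
  exact ⟨hg, by rw [hG]; linarith [hs.2]⟩

/-- `ι₀ (ν₀ q) = q`. [folklore] -/
theorem ι₀_ν₀ (q : (Metric.sphere (0 : EuclideanSpace ℝ (Fin 2)) 1) × EuclideanSpace ℝ (Fin 2)) : E.ι₀ (E.ν₀ q) = q := by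
  have h := E.ι₀_θ q 0 ⟨by linarith [E.δ_pos], E.δ_pos⟩
  rwa [E.θ_zero] at h

/-- `ν₀ (u, w)` lies on the knot iff `w = 0`. [folklore] -/
theorem ν₀_mem_range_iff {u : Metric.sphere (0 : EuclideanSpace ℝ (Fin 2)) 1} {w : EuclideanSpace ℝ (Fin 2)} :
    E.ν₀ (u, w) ∈ range E.K₀ ↔ w = 0 := by
  constructor
  · rintro ⟨u', h⟩
    rw [← E.ν₀_zero] at h
    exact (Prod.ext_iff.1 (E.injective_ν₀ h)).2.symm
  · rintro rfl; exact ⟨u, (E.ν₀_zero u).symm⟩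

/-- `ν₀ (u, τ v) ∉ K₀(𝕊¹)` for `τ ≠ 0`. [folklore] -/
theorem ν₀_smul_not_mem_range {τ : ℝ} (hτ : τ ≠ 0) (u v : Metric.sphere (0 : EuclideanSpace ℝ (Fin 2)) 1) :
    E.ν₀ (u, τ • (v : EuclideanSpace ℝ (Fin 2))) ∉ range E.K₀ := by
  rw [E.ν₀_mem_range_iff]; exact smul_ne_zero hτ (ne_zero_of_mem_unit_sphere v)

/-! ### Points of the trace and of `M_k` in collar/tube coordinates -/

/-- The point of the `0`-handle chart at handle radius `α` over `a ∈ M_k`: `incl (θ(s(α), a))`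
(template: `inl (α⁻¹ • a)`). [folklore] -/
def ptA (α : ℝ) (a : EuclideanSpace ℝ (Fin 4)) : E.Trace := E.incl (E.θ (E.collarTime α, a))

/-- The point of the trace with base coordinates `(α, r)` and angles `(u, v)`: `ptA α (ν₀(u, r v))`
(template `ptT`). [folklore] -/
def ptT (α r : ℝ) (u v : Metric.sphere (0 : EuclideanSpace ℝ (Fin 2)) 1) : E.Trace :=
  E.ptA α (E.ν₀ (u, r • (v : EuclideanSpace ℝ (Fin 2))))

/-- **The handle-chart form** of `ptT`: for `0 < α` and `0 < r < 2`,
`ptT α r u v = inr (α • u, univBall⁻¹ (r • v))`. [folklore] -/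
theorem ptT_eq_inr {α r : ℝ} (hα : 0 < α) (hr : 0 < r) (hr2 : r < 2) (u v : Metric.sphere (0 : EuclideanSpace ℝ (Fin 2)) 1) :
    E.ptT α r u v = E.trGlueData.inr (α • (u : EuclideanSpace ℝ (Fin 2)),
      (OpenPartialHomeomorph.univBall (0 : EuclideanSpace ℝ (Fin 2)) 2).symm (r • (v : EuclideanSpace ℝ (Fin 2)))) := by
  have hs := E.collarTime_mem_Ioo hα
  rw [ptT, ptA, E.incl_eq_inr_iff (E.θ_ν₀_mem_hbNbhd _ hs)]
  refine ⟨smul_ne_zero hα.ne' (ne_zero_of_mem_unit_sphere u), ?_⟩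
  rw [E.bwd_smul hα, E.νK_eq]
  simp only
  rw [TubeNbhd.univBall_apply_symm_apply (by rw [norm_smul_coe_sphere hr.le]; exact hr2)]

/-- The point of `Y` with tube coordinates `(τ, u, v)`: `jM (ν₀(u, τ v))` (template `ptY`). [folklore] -/
def ptY {Y : Type*} (jM : EuclideanSpace ℝ (Fin 4) → Y) (τ : ℝ) (u v : Metric.sphere (0 : EuclideanSpace ℝ (Fin 2)) 1) : Y :=
  jM (E.ν₀ (u, τ • (v : EuclideanSpace ℝ (Fin 2))))

/-- The drop of a point of the band onto `M_k` along the collar flow. [folklore] -/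
def dropA (y : EuclideanSpace ℝ (Fin 4)) : EuclideanSpace ℝ (Fin 4) := E.θ (1 - levelFun k y, y)

/-- The handle radius `α = E(G_k y - 1)` of a point of the band (template `‖y‖⁻¹`). [folklore] -/
def radA (y : EuclideanSpace ℝ (Fin 4)) : ℝ := E.handleRadius (levelFun k y - 1)

/-- `dropA (θ(s, a)) = a` and `radA (θ(s, a)) = E s` for `a ∈ M_k`, `|s| < δ`. [folklore] -/
theorem dropA_radA_θ {a : EuclideanSpace ℝ (Fin 4)} (ha : a ∈ modelBoundary k) {s : ℝ} (hs : s ∈ Ioo (-E.δ) E.δ) :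
    E.dropA (E.θ (s, a)) = a ∧ E.radA (E.θ (s, a)) = E.handleRadius s ∧ levelFun k (E.θ (s, a)) = 1 + s := by
  have hg : ∀ j, (1 : ℝ) / 2 < holeTerm k j a := fun j => lt_of_lt_of_le (by norm_num) (ha.1 j)
  have hG : levelFun k a ∈ Ioo (1 - E.δ) (1 + E.δ) := by rw [ha.2]; exact ⟨by linarith [E.δ_pos], by linarith [E.δ_pos]⟩
  have h := (E.clock a hg hG s (by rw [ha.2]; exact ⟨by linarith [hs.1], by linarith [hs.2]⟩)).2
  rw [ha.2] at h
  refine ⟨?_, by rw [radA, h, add_sub_cancel_left], h⟩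
  rw [dropA, h, show 1 - (1 + s) = -s by ring, E.θ_neg_θ]

/-! ### The collar formulas -/

/-- **Radial formula** — the collar outside the tube: `(a, σ) ↦ incl (θ(s(αof e^{-σ}), a))`
(template `cRad a σ = inl (tof e^{-σ} • a)`). [folklore] -/
def cRad (a : EuclideanSpace ℝ (Fin 4)) (σ : ℝ) : E.Trace := E.ptA (TraceCollar.αof (Real.exp (-σ))) a

/-- The base coordinates `(X, Y) = Φ⁻¹ (e^{-σ}, ‖w‖)` over the tube point `a = ν₀(u, w)`. [folklore] -/
def baseP (a : EuclideanSpace ℝ (Fin 4)) (σ : ℝ) : ℝ × ℝ := TraceCollar.Φinv (Real.exp (-σ), ‖(E.ι₀ a).2‖)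

/-- **Tube formula** — the collar on the tube part: `(ν₀(u, w), σ) ↦ ptT (αof X) (2e^{-Y}) u ŵ`,
`(X, Y) = Φ⁻¹ (e^{-σ}, ‖w‖)`. [folklore] -/
def cTube (a : EuclideanSpace ℝ (Fin 4)) (σ : ℝ) : E.Trace :=
  E.ptT (TraceCollar.αof (E.baseP a σ).1) (2 * Real.exp (-(E.baseP a σ).2)) (E.ι₀ a).1
    (radialProjection (spherePt 1) (E.ι₀ a).2)

/-- **Flat formula** — the collar near the core circle of the surgery solid torus, in the handle chart
(the template's `fF` verbatim). [folklore] -/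
def cFlat (b : EuclideanSpace ℝ (Fin 2) × Metric.sphere (0 : EuclideanSpace ℝ (Fin 2)) 1) (σ : ℝ) : E.Trace :=
  E.trGlueData.inr (TubeNbhd.fF (b, σ))

/-- The closed tube of radius `2`: `ν₀(𝕊¹ × B̄(0, 2)) ⊆ M_k`. [folklore] -/
def closedTube : Set (EuclideanSpace ℝ (Fin 4)) :=
  E.ν₀ '' ((univ : Set (Metric.sphere (0 : EuclideanSpace ℝ (Fin 2)) 1)) ×ˢ closedBall (0 : EuclideanSpace ℝ (Fin 2)) 2)

/-- `ν₀ (u, w) ∈ closedTube ↔ ‖w‖ ≤ 2`. [folklore] -/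
theorem mem_closedTube_iff {u : Metric.sphere (0 : EuclideanSpace ℝ (Fin 2)) 1} {w : EuclideanSpace ℝ (Fin 2)} :
    E.ν₀ (u, w) ∈ E.closedTube ↔ ‖w‖ ≤ 2 := by
  rw [closedTube, E.injective_ν₀.mem_set_image]; simp

/-- The knot lies in the closed tube. [folklore] -/
theorem range_K₀_subset_closedTube : range E.K₀ ⊆ E.closedTube := by
  rintro _ ⟨u, rfl⟩; rw [← E.ν₀_zero, mem_closedTube_iff]; simp

/-- The closed tube lies in `M_k`. [folklore] -/
theorem closedTube_subset_modelBoundary : E.closedTube ⊆ modelBoundary k := by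
  rintro _ ⟨q, -, rfl⟩; exact E.ν₀_mem q

/-- The closed tube is compact. [folklore] -/
theorem isCompact_closedTube : IsCompact E.closedTube :=
  (isCompact_univ.prod (isCompact_closedBall _ _)).image E.contMDiff_ν₀.continuous

/-- The radial part of `Y`: points of `M_k` outside the closed tube. [folklore] -/
def radSet {Y : Type*} (jM : EuclideanSpace ℝ (Fin 4) → Y) : Set Y := jM '' {a | a ∈ modelBoundary k ∧ a ∉ E.closedTube}

/-- The `M_k`-part of `Y`: points of `M_k` off the knot. [folklore] -/
def mSet {Y : Type*} (jM : EuclideanSpace ℝ (Fin 4) → Y) : Set Y := jM '' {a | a ∈ modelBoundary k ∧ a ∉ range E.K₀}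

/-- `radSet ⊆ mSet`. [folklore] -/
theorem radSet_subset_mSet {Y : Type*} (jM : EuclideanSpace ℝ (Fin 4) → Y) : E.radSet jM ⊆ E.mSet jM := by
  rintro _ ⟨a, ⟨ha, ha'⟩, rfl⟩
  exact ⟨a, ⟨ha, fun h => ha' (E.range_K₀_subset_closedTube h)⟩, rfl⟩

open Classical in
/-- **The collar** `Y × ℝ → T` (three formulas on an open cover). [folklore] -/
def collar {Y : Type*} (jM : EuclideanSpace ℝ (Fin 4) → Y) (jB : ↥solidTorus → Y) (ψ : Y → EuclideanSpace ℝ (Fin 4))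
    (p : Y × ℝ) : E.Trace :=
  if p.1 ∈ E.radSet jM then E.cRad (ψ p.1) p.2
  else if p.1 ∈ E.mSet jM then E.cTube (ψ p.1) p.2
  else E.cFlat (TubeNbhd.invB jB p.1) p.2

/-- **Radial inverse formula**: `y ↦ (jM (drop y), -log ξ(E(G_k y - 1)))`. [folklore] -/
def ΨRad {Y : Type*} (jM : EuclideanSpace ℝ (Fin 4) → Y) (y : EuclideanSpace ℝ (Fin 4)) : Y × ℝ :=
  (jM (E.dropA y), -Real.log (TraceCollar.ξ (E.radA y)))

/-- The profile values `(N, T) = Φ (ξ(α), log (2/‖w‖))` at the point `y` of the band with handle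
radius `α` and direction `drop y = ν₀ (u, w)`. [folklore] -/
def profP (y : EuclideanSpace ℝ (Fin 4)) : ℝ × ℝ :=
  TraceCollar.Φ (TraceCollar.ξ (E.radA y), Real.log (2 / ‖(E.ι₀ (E.dropA y)).2‖))

/-- **Tube inverse formula**: `y ↦ (ptY T u ŵ, -log N)`. [folklore] -/
def ΨTube {Y : Type*} (jM : EuclideanSpace ℝ (Fin 4) → Y) (y : EuclideanSpace ℝ (Fin 4)) : Y × ℝ :=
  (E.ptY jM (E.profP y).2 (E.ι₀ (E.dropA y)).1 (radialProjection (spherePt 1) (E.ι₀ (E.dropA y)).2),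
    -Real.log (E.profP y).1)

/-- The radial region of the trace: `incl` of band points outside `D_k` whose drop is outside the closed
tube. [folklore] -/
def radSetT : Set E.Trace := E.incl '' {y | y ∈ E.hbNbhd ∧ 1 < levelFun k y ∧ E.dropA y ∉ E.closedTube}

open Classical in
/-- **The inverse collar** `T → Y × ℝ` (meaningful off the core). [folklore] -/
def collarInv {Y : Type*} (jM : EuclideanSpace ℝ (Fin 4) → Y) (jB : ↥solidTorus → Y) (z : E.Trace) : Y × ℝ :=
  if z ∈ E.radSetT then E.ΨRad jM (E.πl z)
  else if z ∈ E.incl '' E.hbNbhd then E.ΨTube jM (E.πl z)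
  else TubeNbhd.ΨFlat jB (E.πr z)

/-! ### The presentation of `Y` and branch evaluation -/

/-- **A presentation of `Y` as `M_k` surgered along `K₀` via `ν₀`** (set-theoretic part): `jM` on
`M_k ∖ K₀` with inverse `ψ`, the new solid torus `jB`, covering `Y` and glued by
`jM (ν₀(u, t v)) = jB (t u, v)`, `0 < t < 1` — the hypothesis block of `helper_friendsCarrier_Tk`, bundled
(the smoothness clauses are added in `SmoothPresentation`, later). [folklore] -/
structure Presentation (Y : Type*) [TopologicalSpace Y] [ChartedSpace (EuclideanSpace ℝ (Fin 3)) Y] where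
  /-- The presentation of `M_k ∖ K₀` (total on `ℝ⁴`). -/
  jM : EuclideanSpace ℝ (Fin 4) → Y
  /-- The surgery solid torus. -/
  jB : ↥solidTorus → Y
  /-- An open set of `ℝ⁴` containing `M_k ∖ K₀` on which `jM` is smooth. -/
  W : Set (EuclideanSpace ℝ (Fin 4))
  /-- The inverse of `jM` (total on `Y`). -/
  ψ : Y → EuclideanSpace ℝ (Fin 4)
  injective_jB : Injective jB
  ψ_jM : ∀ x ∈ modelBoundary k, x ∉ range E.K₀ → ψ (jM x) = x
  cover : jM '' {x : EuclideanSpace ℝ (Fin 4) | x ∈ modelBoundary k ∧ x ∉ range E.K₀} ∪ range jB = univ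
  rel : ∀ x ∈ modelBoundary k, x ∉ range E.K₀ → ∀ b : ↥solidTorus, jM x = jB b ↔
    ∃ (u : Metric.sphere (0 : EuclideanSpace ℝ (Fin 2)) 1) (t : ℝ), t ∈ Ioo (0 : ℝ) 1 ∧
      (b : EuclideanSpace ℝ (Fin 2) × Metric.sphere (0 : EuclideanSpace ℝ (Fin 2)) 1).1 = t • (u : EuclideanSpace ℝ (Fin 2)) ∧
      x = E.ν₀ (u, t • ((b : EuclideanSpace ℝ (Fin 2) × Metric.sphere (0 : EuclideanSpace ℝ (Fin 2)) 1).2 : EuclideanSpace ℝ (Fin 2)))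

namespace Presentation

variable {E} {Y : Type*} [TopologicalSpace Y] [ChartedSpace (EuclideanSpace ℝ (Fin 3)) Y] (P : E.Presentation Y)

/-- `jM` is injective on `M_k ∖ K₀`. [folklore] -/
theorem injOn_jM : InjOn P.jM {x : EuclideanSpace ℝ (Fin 4) | x ∈ modelBoundary k ∧ x ∉ range E.K₀} := fun x hx x' hx' h => by
  rw [← P.ψ_jM x hx.1 hx.2, ← P.ψ_jM x' hx'.1 hx'.2, h]

/-- `invB (jB b) = b`. [folklore] -/
theorem invB_apply (b : ↥solidTorus) : TubeNbhd.invB P.jB (P.jB b) = b := by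
  rw [TubeNbhd.invB, Function.leftInverse_invFun P.injective_jB b]

/-- The core circle of the surgery solid torus is not in the `M_k`-part. [folklore] -/
theorem jB_zero_not_mem (v : Metric.sphere (0 : EuclideanSpace ℝ (Fin 2)) 1)
    (h : ((0 : EuclideanSpace ℝ (Fin 2)), v) ∈ solidTorus) : P.jB ⟨((0 : EuclideanSpace ℝ (Fin 2)), v), h⟩ ∉ E.mSet P.jM := by
  rintro ⟨a, ha, hab⟩
  obtain ⟨u, t, ht, hb, -⟩ := (P.rel a ha.1 ha.2 _).1 hab
  simp only at hb
  exact smul_ne_zero ht.1.ne' (ne_zero_of_mem_unit_sphere u) hb.symm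

/-- A point of the solid torus off its core circle is in the `M_k`-part: `jB (p, v) = jM (ν₀(p̂, ‖p‖ v))`.
[folklore] -/
theorem jB_eq_jM (b : ↥solidTorus)
    (hb : (b : EuclideanSpace ℝ (Fin 2) × Metric.sphere (0 : EuclideanSpace ℝ (Fin 2)) 1).1 ≠ 0) :
    P.jB b = P.jM (E.ν₀ (radialProjection (spherePt 1) (b : EuclideanSpace ℝ (Fin 2) × Metric.sphere (0 : EuclideanSpace ℝ (Fin 2)) 1).1,
      ‖(b : EuclideanSpace ℝ (Fin 2) × Metric.sphere (0 : EuclideanSpace ℝ (Fin 2)) 1).1‖ •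
        ((b : EuclideanSpace ℝ (Fin 2) × Metric.sphere (0 : EuclideanSpace ℝ (Fin 2)) 1).2 : EuclideanSpace ℝ (Fin 2)))) := by
  have hlt : ‖(b : EuclideanSpace ℝ (Fin 2) × Metric.sphere (0 : EuclideanSpace ℝ (Fin 2)) 1).1‖ < 1 := (mem_solidTorus_iff _).1 b.2
  have hpos : 0 < ‖(b : EuclideanSpace ℝ (Fin 2) × Metric.sphere (0 : EuclideanSpace ℝ (Fin 2)) 1).1‖ := norm_pos_iff.2 hb
  symm
  rw [P.rel _ (E.ν₀_mem _) (E.ν₀_smul_not_mem_range hpos.ne' _ _)]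
  exact ⟨_, _, ⟨hpos, hlt⟩, (norm_smul_coe_radialProjection _ _).symm, rfl⟩

/-- A point of the solid torus off its core circle is in the `M_k`-part. [folklore] -/
theorem jB_mem_mSet (b : ↥solidTorus)
    (hb : (b : EuclideanSpace ℝ (Fin 2) × Metric.sphere (0 : EuclideanSpace ℝ (Fin 2)) 1).1 ≠ 0) : P.jB b ∈ E.mSet P.jM := by
  rw [P.jB_eq_jM b hb]
  exact ⟨_, ⟨E.ν₀_mem _, E.ν₀_smul_not_mem_range (norm_pos_iff.2 hb).ne' _ _⟩, rfl⟩

/-- A point of `Y` outside the `M_k`-part lies on the core circle of the surgery solid torus. [folklore] -/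
theorem eq_jB_zero_of_not_mem {y : Y} (hy : y ∉ E.mSet P.jM) :
    ∃ (v : Metric.sphere (0 : EuclideanSpace ℝ (Fin 2)) 1) (h : ((0 : EuclideanSpace ℝ (Fin 2)), v) ∈ solidTorus),
      P.jB ⟨((0 : EuclideanSpace ℝ (Fin 2)), v), h⟩ = y := by
  have hcov := P.cover ▸ mem_univ y
  rcases hcov with hy' | ⟨b, rfl⟩
  · exact absurd hy' hy
  · have hb : (b : EuclideanSpace ℝ (Fin 2) × Metric.sphere (0 : EuclideanSpace ℝ (Fin 2)) 1).1 = 0 := by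
      by_contra h; exact hy (P.jB_mem_mSet b h)
    refine ⟨(b : EuclideanSpace ℝ (Fin 2) × Metric.sphere (0 : EuclideanSpace ℝ (Fin 2)) 1).2, ?_, ?_⟩
    · simp [mem_solidTorus_iff]
    · congr 1; ext1
      exact Prod.ext hb.symm rfl

/-- `jM a ∈ radSet` iff `a` is outside the closed tube (`a ∈ M_k ∖ K₀`). [folklore] -/
theorem jM_mem_radSet_iff {a : EuclideanSpace ℝ (Fin 4)} (ha : a ∈ modelBoundary k) (ha' : a ∉ range E.K₀) :
    P.jM a ∈ E.radSet P.jM ↔ a ∉ E.closedTube := by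
  constructor
  · rintro ⟨a', ⟨ha'1, ha'2⟩, h⟩
    rw [P.injOn_jM ⟨ha'1, fun hm => ha'2 (E.range_K₀_subset_closedTube hm)⟩ ⟨ha, ha'⟩ h] at ha'2
    exact ha'2
  · exact fun h => ⟨a, ⟨ha, h⟩, rfl⟩

/-- **Branch R**: outside the closed tube the collar is the radial formula. [folklore] -/
theorem collar_of_not_mem_closedTube {a : EuclideanSpace ℝ (Fin 4)} (ha : a ∈ modelBoundary k) (hat : a ∉ E.closedTube) (σ : ℝ) :
    E.collar P.jM P.jB P.ψ (P.jM a, σ) = E.cRad a σ := by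
  have ha' : a ∉ range E.K₀ := fun h => hat (E.range_K₀_subset_closedTube h)
  rw [collar, if_pos ((P.jM_mem_radSet_iff ha ha').2 hat), P.ψ_jM a ha ha']

/-- **Branch P**: on the closed tube (off the knot) the collar is the tube formula. [folklore] -/
theorem collar_of_mem_closedTube {a : EuclideanSpace ℝ (Fin 4)} (ha : a ∈ modelBoundary k) (ha' : a ∉ range E.K₀)
    (hat : a ∈ E.closedTube) (σ : ℝ) : E.collar P.jM P.jB P.ψ (P.jM a, σ) = E.cTube a σ := by
  rw [collar, if_neg (fun h => (P.jM_mem_radSet_iff ha ha').1 h hat), if_pos ⟨a, ⟨ha, ha'⟩, rfl⟩, P.ψ_jM a ha ha']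

/-- **Branch F**: over the core circle of the surgery solid torus the collar is the flat formula. [folklore] -/
theorem collar_of_core (v : Metric.sphere (0 : EuclideanSpace ℝ (Fin 2)) 1) (h : ((0 : EuclideanSpace ℝ (Fin 2)), v) ∈ solidTorus)
    (σ : ℝ) : E.collar P.jM P.jB P.ψ (P.jB ⟨((0 : EuclideanSpace ℝ (Fin 2)), v), h⟩, σ) = E.cFlat ((0 : EuclideanSpace ℝ (Fin 2)), v) σ := by
  have h1 := P.jB_zero_not_mem v h
  rw [collar, if_neg (fun h' => h1 (E.radSet_subset_mSet P.jM h')), if_neg h1, P.invB_apply]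

end Presentation

end EndDatum

end FriendsTk

/-- **Helper `helper_friendsCarrier_Tk_endFormulas`** (registered on the crux item; end collar part 1 of
stub `helper_friendsCarrier_Tk`): for the trace built from the fibre-shrunken tube `ν₀'` of a tube `ν₀`
in `M_k`, the HANDLE-CHART FORM of the collar points — for `0 < α`, `0 < r < 2` the point
`incl (θ(δ(1 - α)/(1 + α), ν₀(u, r v)))` of the `0`-handle chart is the point
`inr (α • u, univBall⁻¹ (r • v))` of the `2`-handle chart (the template's `ptT_eq_inr`) — together with
the clock and the drop along `θ(·, ν₀ q)`: the identities on which the three collar formulas agree on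
their overlaps (Kirby 1989, Ch. I §5). [cite: Kirby1989, Ch. I §5] -/
theorem helper_friendsCarrier_Tk_endFormulas : ∀ (k : ℕ) (ν₀ νK : (sphere (0 : EuclideanSpace ℝ (Fin 2)) 1) × EuclideanSpace ℝ (Fin 2) → EuclideanSpace ℝ (Fin 4)) (θ : ℝ × EuclideanSpace ℝ (Fin 4) → EuclideanSpace ℝ (Fin 4)) (δ : ℝ) (ι : EuclideanSpace ℝ (Fin 4) → (sphere (0 : EuclideanSpace ℝ (Fin 2)) 1) × EuclideanSpace ℝ (Fin 2)), (∀ q, νK q = ν₀ (q.1, OpenPartialHomeomorph.univBall (0 : EuclideanSpace ℝ (Fin 2)) 2 q.2)) → (∀ p, ν₀ p ∈ modelBoundary k) → 0 < δ → δ < 1 → ContDiff ℝ ((⊤ : ℕ∞) : WithTop ℕ∞) θ → (∀ x, θ (0, x) = x) → (∀ t s x, θ (t, θ (s, x)) = θ (t + s, x)) → (∀ y : EuclideanSpace ℝ (Fin 4), (∀ j, (1 : ℝ) / 2 < holeTerm k j y) → levelFun k y ∈ Ioo (1 - δ) (1 + δ) → ∀ t : ℝ, levelFun k y + t ∈ Ioo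 (1 - δ) (1 + δ) → (∀ j, (1 : ℝ) / 2 < holeTerm k j (θ (t, y))) ∧ levelFun k (θ (t, y)) = levelFun k y + t) → (∀ a ∈ modelBoundary k, ∀ s ∈ Ioo (-δ) δ, (θ (s, a) ∈ modelHandlebody k ↔ s ≤ 0)) → ContMDiff ((𝓡 1).prod 𝓘(ℝ, EuclideanSpace ℝ (Fin 2))) 𝓘(ℝ, EuclideanSpace ℝ (Fin 4)) ((⊤ : ℕ∞) : WithTop ℕ∞) νK → (∀ p, νK p ∈ modelBoundary k) → IsOpen {y : EuclideanSpace ℝ (Fin 4) | (∀ j, (1 : ℝ) / 2 < holeTerm k j y) ∧ levelFun k y ∈ Ioo (1 - δ) (1 + δ) ∧ θ (1 - levelFun k y, y) ∈ range νK} → ContMDiffOn 𝓘(ℝ, EuclideanSpace ℝ (Fin 4)) ((𝓡 1).prod 𝓘(ℝ, EuclideanSpace ℝ (Fin 2))) ((⊤ : ℕ∞) : WithTop ℕ∞) ι {y : EuclideanSpace ℝ (Fin 4) | (∀ j, (1 : ℝ) / 2 < holeTerm k j y) ∧ levelFun k y ∈ Ioo (1 - δ) (1 + δ) ∧ θ (1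 - levelFun k y, y) ∈ range νK} → (∀ (q : (sphere (0 : EuclideanSpace ℝ (Fin 2)) 1) × EuclideanSpace ℝ (Fin 2)) (s : ℝ), s ∈ Ioo (-δ) δ → ι (θ (s, νK q)) = q) → (∀ y ∈ {y : EuclideanSpace ℝ (Fin 4) | (∀ j, (1 : ℝ) / 2 < holeTerm k j y) ∧ levelFun k y ∈ Ioo (1 - δ) (1 + δ) ∧ θ (1 - levelFun k y, y) ∈ range νK}, θ (levelFun k y - 1, νK (ι y)) = y) → ∃ (X : Type) (_ : TopologicalSpace X) (_ : T2Space X) (_ : ChartedSpace (EuclideanSpace ℝ (Fin 4)) X) (_ : IsManifold (𝓡 4) ((⊤ : ℕ∞) : WithTop ℕ∞) X) (i : EuclideanSpace ℝ (Fin 4) → X) (h : EuclideanSpace ℝ (Fin 2) × EuclideanSpace ℝ (Fin 2) → X), ContMDiffOn (𝓡 4) (𝓡 4) ((⊤ : ℕ∞) : WithTop ℕ∞) i {y : EuclideanSpace ℝ (Fin 4) | (∀ j, (1 : ℝ) / 2 < holeTerm k j y) ∧ levelFun k y < 1 + δ} ∧ ContMDiff 𝓘(ℝ, EuclideanSpace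 ℝ (Fin 2) × EuclideanSpace ℝ (Fin 2)) (𝓡 4) ((⊤ : ℕ∞) : WithTop ℕ∞) h ∧ i '' {y : EuclideanSpace ℝ (Fin 4) | (∀ j, (1 : ℝ) / 2 < holeTerm k j y) ∧ levelFun k y < 1 + δ} ∪ range h = univ ∧ (∀ y ∈ {y : EuclideanSpace ℝ (Fin 4) | (∀ j, (1 : ℝ) / 2 < holeTerm k j y) ∧ levelFun k y < 1 + δ}, ∀ p : EuclideanSpace ℝ (Fin 2) × EuclideanSpace ℝ (Fin 2), i y = h p ↔ p.1 ≠ 0 ∧ θ (δ * (1 - ‖p.1‖) / (1 + ‖p.1‖), νK (radialProjection (spherePt 1) p.1, p.2)) = y) ∧ (∀ (α r : ℝ) (u v : (sphere (0 : EuclideanSpace ℝ (Fin 2)) 1)), 0 < α → 0 < r → r < 2 → i (θ (δ * (1 - α) / (1 + α), ν₀ (u, r • (v : EuclideanSpace ℝ (Fin 2))))) = h (α • (u : EuclideanSpace ℝ (Fin 2)), (OpenPartialHomeomorph.univBall (0 : EuclideanSpace ℝ (Fin 2)) 2).symm (r • (v : EuclideanSpace ℝ (Fin 2))))) ∧ (∀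 (α : ℝ) (u v : (sphere (0 : EuclideanSpace ℝ (Fin 2)) 1)), 0 < α → levelFun k (θ (δ * (1 - α) / (1 + α), ν₀ (u, v))) = 1 + δ * (1 - α) / (1 + α) ∧ θ (1 - levelFun k (θ (δ * (1 - α) / (1 + α), ν₀ (u, v))), θ (δ * (1 - α) / (1 + α), ν₀ (u, v))) = ν₀ (u, v)) := by
  intro k ν₀ νK θ δ ι hνK hν₀ hδ hδ1 hθ h0 hadd hclock hiff hν hmem hopen hι hιθ hθι
  let D : FriendsTk.TraceDatum k := ⟨νK, θ, δ, ι, hδ, hδ1, hθ, h0, hadd, hclock, hiff, hν, hmem, hopen, hι, hιθ, hθι⟩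
  have hband : ∀ (q : (Metric.sphere (0 : EuclideanSpace ℝ (Fin 2)) 1) × EuclideanSpace ℝ (Fin 2)) {s : ℝ},
      s ∈ Set.Ioo (-δ) δ → (∀ j, (1 : ℝ) / 2 < holeTerm k j (θ (s, ν₀ q))) ∧ levelFun k (θ (s, ν₀ q)) = 1 + s := by
    intro q s hs
    have hm := hν₀ q
    have hg : ∀ j, (1 : ℝ) / 2 < holeTerm k j (ν₀ q) := fun j => lt_of_lt_of_le (by norm_num) (hm.1 j)
    have hG : levelFun k (ν₀ q) ∈ Set.Ioo (1 - δ) (1 + δ) := by rw [hm.2]; exact ⟨by linarith, by linarith⟩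
    have h := hclock (ν₀ q) hg hG s (by rw [hm.2]; exact ⟨by linarith [hs.1], by linarith [hs.2]⟩)
    rw [hm.2] at h
    exact h
  refine ⟨D.Trace, inferInstance, inferInstance, inferInstance, inferInstance, D.incl, D.trGlueData.inr,
    D.contMDiffOn_incl, D.trGlueData.contMDiff_inr, D.image_incl_union_range_inr, fun y hy p => D.incl_eq_inr_iff hy,
    fun α r u v hα hr hr2 => ?_, fun α u v hα => ?_⟩
  · have hs : δ * (1 - α) / (1 + α) ∈ Set.Ioo (-δ) δ := D.collarTime_mem_Ioo hα
    have hmem' : θ (δ * (1 - α) / (1 + α), ν₀ (u, r • (v : EuclideanSpace ℝ (Fin 2)))) ∈ D.hbNbhd := by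
      obtain ⟨hg, hG⟩ := hband (u, r • (v : EuclideanSpace ℝ (Fin 2))) hs
      refine ⟨hg, ?_⟩
      show levelFun k (θ (δ * (1 - α) / (1 + α), ν₀ (u, r • (v : EuclideanSpace ℝ (Fin 2))))) < 1 + δ
      rw [hG]; linarith [hs.2]
    rw [D.incl_eq_inr_iff hmem']
    refine ⟨smul_ne_zero hα.ne' (ne_zero_of_mem_unit_sphere u), ?_⟩
    rw [D.bwd_smul hα]
    show θ (δ * (1 - α) / (1 + α), νK (u, (OpenPartialHomeomorph.univBall (0 : EuclideanSpace ℝ (Fin 2)) 2).symm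
      (r • (v : EuclideanSpace ℝ (Fin 2))))) = θ (δ * (1 - α) / (1 + α), ν₀ (u, r • (v : EuclideanSpace ℝ (Fin 2))))
    rw [hνK]
    simp only
    rw [TubeNbhd.univBall_apply_symm_apply (by rw [norm_smul_coe_sphere hr.le]; exact hr2)]
  · have hs : δ * (1 - α) / (1 + α) ∈ Set.Ioo (-δ) δ := D.collarTime_mem_Ioo hα
    obtain ⟨-, hG⟩ := hband (u, (v : EuclideanSpace ℝ (Fin 2))) hs
    refine ⟨hG, ?_⟩
    rw [hG, show 1 - (1 + δ * (1 - α) / (1 + α)) = -(δ * (1 - α) / (1 + α)) by ring, hadd, neg_add_cancel, h0]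

end Summit.SmoothPoincare4.SmoothPoincare4.Theorems.DcrGap.MkFriends

end
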